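import Summits.KontsevichZagierPeriods.Zeta5Search.Certificates.VIMReduction
import Summits.KontsevichZagierPeriods.Zeta5Search.Certificates.PolyReflectCoord
import HarnessLib

/-!
# ζ(5) search — brown9: relation instances in the tensor module `T ⊗ T` (pair symbols) (cell `pub-zeta5`, certifier `cert-2`)

HONEST FRAMING: systematic search; recurrence certificates; no irrationality claim unless certified.

For the triple sum `L(n,k₃) = Σ_{k₂} (−1)^{k₂} C(n,k₂)·T(n;p,q₁)·T(n;p,q₂)` (`p = 3n−k₂−k₃`, `q₁ = 3n−k₃`, `q₂ = 2n−k₂`) the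
module-reduction symbols are PAIRS `T(n+i₁;P+j₁,Q₁+l₁)·T(n+i₂;P+j₂,Q₂+l₂)` (`P = 3n−x−k`, `Q₁ = 3n−x`, `Q₂ = 2n−k`,
`x = k₃`, `k = k₂`): table entries `(i₁,j₁,l₁,i₂,j₂,l₂)`, valuation `TvL`. A level-1 relation of cert-1 applied to ONE
factor, the other factor fixed, is an instance `instP2g/instM3g` (`VIMReduction`) with the factor's argument forms
(`argQ1 l = 3n−x+l` for factor 1, `argQ l = 2n−k+l` for factor 2); the four table lemmas `lcEval_instP2_f1/_f2`,
`lcEval_instM3_f1/_f2` say such instances evaluate to `0` (the fixed factor is the free multiplier `V` of the generic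
lemmas). Used by `ModRedLK3Kernel` (and, with `N1`, by the L-NK replay).
-/

noncomputable section

namespace Summit.KontsevichZagierPeriods.Zeta5Search.Certificates

namespace VIMInner

open Summit.KontsevichZagierPeriods.Zeta5Search.PolyReflect

/-- Valuation of pair symbols: entry `(i₁,j₁,l₁,i₂,j₂,l₂)` ↦ `T(n+i₁;P+j₁,Q₁+l₁)·T(n+i₂;P+j₂,Q₂+l₂)` (`0` past the table). -/
def TvL (tab : List (ℕ × ℤ × ℤ × ℕ × ℤ × ℤ)) (n : ℕ) (x : ℚ) (k : ℕ) (s : ℕ) : ℚ :=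
  match tab[s]? with
  | some (i₁, j₁, l₁, i₂, j₂, l₂) =>
    T (n + i₁) (3 * (n : ℚ) - x - k + j₁) (3 * (n : ℚ) - x + l₁) *
      T (n + i₂) (3 * (n : ℚ) - x - k + j₂) (2 * (n : ℚ) - k + l₂)
  | none => 0

/-- Value of a tabulated pair symbol. -/
theorem TvL_of_eq {tab : List (ℕ × ℤ × ℤ × ℕ × ℤ × ℤ)} {n : ℕ} {x : ℚ} {k s : ℕ} {i₁ : ℕ} {j₁ l₁ : ℤ} {i₂ : ℕ}
    {j₂ l₂ : ℤ} (h : tab[s]? = some (i₁, j₁, l₁, i₂, j₂, l₂)) :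
    TvL tab n x k s = T (n + i₁) (3 * (n : ℚ) - x - k + j₁) (3 * (n : ℚ) - x + l₁) *
      T (n + i₂) (3 * (n : ℚ) - x - k + j₂) (2 * (n : ℚ) - k + l₂) := by
  simp [TvL, h]

/-- The `q`-argument form of the FIRST factor: `Q₁ + l = 3n − x + l`. -/
def argQ1 (l : ℤ) : Poly3 := lin3 3 (-1) 0 l

/-- Value of `argQ1`. -/
theorem ev3_argQ1 (l : ℤ) (n : ℕ) (x : ℚ) (k : ℕ) : ev3 (argQ1 l) n x k = 3 * (n : ℚ) - x + l := by
  simp [argQ1]; ring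

/-- **(P2) on factor 1** (factor 2 fixed) evaluates to zero (`n + i ≥ 2`). -/
theorem lcEval_instP2_f1 (tab : List (ℕ × ℤ × ℤ × ℕ × ℤ × ℤ)) (n : ℕ) (x : ℚ) (k : ℕ) (i : ℕ) (j l : ℤ) (i₂ : ℕ)
    (j₂ l₂ : ℤ) (s₀ s₁ s₂ : ℕ) (hn : 2 ≤ n + i) (h₀ : tab[s₀]? = some (i, j, l, i₂, j₂, l₂))
    (h₁ : tab[s₁]? = some (i, j + 1, l, i₂, j₂, l₂)) (h₂ : tab[s₂]? = some (i, j + 2, l, i₂, j₂, l₂)) :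
    lcEval (TvL tab n x k) n x k 0 (instP2g (argN i) (argP j) (argQ1 l) s₀ s₁ s₂) = 0 := by
  obtain ⟨eN, eP, -⟩ := ev3_args i j l n x k
  refine lcEval_instP2g _ _ _ _ _ _ _ _ _ _ (n + i) hn _ _
    (T (n + i₂) (3 * (n : ℚ) - x - k + j₂) (2 * (n : ℚ) - k + l₂)) eN eP (ev3_argQ1 l n x k) ?_ ?_ ?_
  · rw [TvL_of_eq h₀]
  · rw [TvL_of_eq h₁]; push_cast; ring_nf
  · rw [TvL_of_eq h₂]; push_cast; ring_nf

/-- **(M3) on factor 1** (factor 2 fixed) evaluates to zero (`n + i ≥ 1`). -/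
theorem lcEval_instM3_f1 (tab : List (ℕ × ℤ × ℤ × ℕ × ℤ × ℤ)) (n : ℕ) (x : ℚ) (k : ℕ) (i : ℕ) (j l : ℤ) (i₂ : ℕ)
    (j₂ l₂ : ℤ) (s₀ s₁ s₂ : ℕ) (hn : 1 ≤ n + i) (h₀ : tab[s₀]? = some (i, j, l, i₂, j₂, l₂))
    (h₁ : tab[s₁]? = some (i, j + 1, l, i₂, j₂, l₂)) (h₂ : tab[s₂]? = some (i, j, l + 1, i₂, j₂, l₂)) :
    lcEval (TvL tab n x k) n x k 0 (instM3g (argN i) (argP j) (argQ1 l) s₀ s₁ s₂) = 0 := by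
  obtain ⟨eN, eP, -⟩ := ev3_args i j l n x k
  refine lcEval_instM3g _ _ _ _ _ _ _ _ _ _ (n + i) hn _ _
    (T (n + i₂) (3 * (n : ℚ) - x - k + j₂) (2 * (n : ℚ) - k + l₂)) eN eP (ev3_argQ1 l n x k) ?_ ?_ ?_
  · rw [TvL_of_eq h₀]
  · rw [TvL_of_eq h₁]; push_cast; ring_nf
  · rw [TvL_of_eq h₂]; push_cast; ring_nf

/-- **(P2) on factor 2** (factor 1 fixed) evaluates to zero (`n + i ≥ 2`). -/
theorem lcEval_instP2_f2 (tab : List (ℕ × ℤ × ℤ × ℕ × ℤ × ℤ)) (n : ℕ) (x : ℚ) (k : ℕ) (i₁ : ℕ) (j₁ l₁ : ℤ) (i : ℕ)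
    (j l : ℤ) (s₀ s₁ s₂ : ℕ) (hn : 2 ≤ n + i) (h₀ : tab[s₀]? = some (i₁, j₁, l₁, i, j, l))
    (h₁ : tab[s₁]? = some (i₁, j₁, l₁, i, j + 1, l)) (h₂ : tab[s₂]? = some (i₁, j₁, l₁, i, j + 2, l)) :
    lcEval (TvL tab n x k) n x k 0 (instP2g (argN i) (argP j) (argQ l) s₀ s₁ s₂) = 0 := by
  obtain ⟨eN, eP, eQ⟩ := ev3_args i j l n x k
  refine lcEval_instP2g _ _ _ _ _ _ _ _ _ _ (n + i) hn _ _
    (T (n + i₁) (3 * (n : ℚ) - x - k + j₁) (3 * (n : ℚ) - x + l₁)) eN eP eQ ?_ ?_ ?_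
  · rw [TvL_of_eq h₀, mul_comm]
  · rw [TvL_of_eq h₁]; push_cast; ring_nf
  · rw [TvL_of_eq h₂]; push_cast; ring_nf

/-- **(M3) on factor 2** (factor 1 fixed) evaluates to zero (`n + i ≥ 1`). -/
theorem lcEval_instM3_f2 (tab : List (ℕ × ℤ × ℤ × ℕ × ℤ × ℤ)) (n : ℕ) (x : ℚ) (k : ℕ) (i₁ : ℕ) (j₁ l₁ : ℤ) (i : ℕ)
    (j l : ℤ) (s₀ s₁ s₂ : ℕ) (hn : 1 ≤ n + i) (h₀ : tab[s₀]? = some (i₁, j₁, l₁, i, j, l))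
    (h₁ : tab[s₁]? = some (i₁, j₁, l₁, i, j + 1, l)) (h₂ : tab[s₂]? = some (i₁, j₁, l₁, i, j, l + 1)) :
    lcEval (TvL tab n x k) n x k 0 (instM3g (argN i) (argP j) (argQ l) s₀ s₁ s₂) = 0 := by
  obtain ⟨eN, eP, eQ⟩ := ev3_args i j l n x k
  refine lcEval_instM3g _ _ _ _ _ _ _ _ _ _ (n + i) hn _ _
    (T (n + i₁) (3 * (n : ℚ) - x - k + j₁) (3 * (n : ℚ) - x + l₁)) eN eP eQ ?_ ?_ ?_
  · rw [TvL_of_eq h₀, mul_comm]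
  · rw [TvL_of_eq h₁]; push_cast; ring_nf
  · rw [TvL_of_eq h₂]; push_cast; ring_nf

/-- **(N1) on factor 1** (factor 2 fixed) evaluates to zero (`n + i ≥ 1`): symbols `(i+1,j,l|o)`, `(i,j,l|o)`, `(i,j+1,l|o)`. -/
theorem lcEval_instN1_f1 (tab : List (ℕ × ℤ × ℤ × ℕ × ℤ × ℤ)) (n : ℕ) (x : ℚ) (k : ℕ) (i : ℕ) (j l : ℤ) (i₂ : ℕ)
    (j₂ l₂ : ℤ) (s₀ s₁ s₂ : ℕ) (hn : 1 ≤ n + i) (h₀ : tab[s₀]? = some (i + 1, j, l, i₂, j₂, l₂))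
    (h₁ : tab[s₁]? = some (i, j, l, i₂, j₂, l₂)) (h₂ : tab[s₂]? = some (i, j + 1, l, i₂, j₂, l₂)) :
    lcEval (TvL tab n x k) n x k 0 (instN1g (argN i) (argP j) (argQ1 l) s₀ s₁ s₂) = 0 := by
  obtain ⟨eN, eP, -⟩ := ev3_args i j l n x k
  refine lcEval_instN1g _ _ _ _ _ _ _ _ _ _ (n + i) hn _ _
    (T (n + i₂) (3 * (n : ℚ) - x - k + j₂) (2 * (n : ℚ) - k + l₂)) eN eP (ev3_argQ1 l n x k) ?_ ?_ ?_
  · rw [TvL_of_eq h₀, show n + (i + 1) = n + i + 1 by ring]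
  · rw [TvL_of_eq h₁]
  · rw [TvL_of_eq h₂]; push_cast; ring_nf

/-- **(N1) on factor 2** (factor 1 fixed) evaluates to zero (`n + i ≥ 1`): symbols `(o|i+1,j,l)`, `(o|i,j,l)`, `(o|i,j+1,l)`. -/
theorem lcEval_instN1_f2 (tab : List (ℕ × ℤ × ℤ × ℕ × ℤ × ℤ)) (n : ℕ) (x : ℚ) (k : ℕ) (i₁ : ℕ) (j₁ l₁ : ℤ) (i : ℕ)
    (j l : ℤ) (s₀ s₁ s₂ : ℕ) (hn : 1 ≤ n + i) (h₀ : tab[s₀]? = some (i₁, j₁, l₁, i + 1, j, l))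
    (h₁ : tab[s₁]? = some (i₁, j₁, l₁, i, j, l)) (h₂ : tab[s₂]? = some (i₁, j₁, l₁, i, j + 1, l)) :
    lcEval (TvL tab n x k) n x k 0 (instN1g (argN i) (argP j) (argQ l) s₀ s₁ s₂) = 0 := by
  obtain ⟨eN, eP, eQ⟩ := ev3_args i j l n x k
  refine lcEval_instN1g _ _ _ _ _ _ _ _ _ _ (n + i) hn _ _
    (T (n + i₁) (3 * (n : ℚ) - x - k + j₁) (3 * (n : ℚ) - x + l₁)) eN eP eQ ?_ ?_ ?_
  · rw [TvL_of_eq h₀, mul_comm, show n + (i + 1) = n + i + 1 by ring]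
  · rw [TvL_of_eq h₁, mul_comm]
  · rw [TvL_of_eq h₂]; push_cast; ring_nf

end VIMInner

end Summit.KontsevichZagierPeriods.Zeta5Search.Certificates
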